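import Literature.AnabelianGeometry.EtaleTheta.Discharge.Sec5Thm510
import Literature.AnabelianGeometry.EtaleTheta.Discharge.Sec5Thm510OfRootTransport
import Literature.AnabelianGeometry.EtaleTheta.FrobenioidKummerOut
import Literature.AnabelianGeometry.EtaleTheta.AutOutDictionary

/-!
# [EtTh] §5, Theorem 5.10 (iii) at the HONEST, NONEMPTY `K^×`-part of `D` (pp. 331–335 / PDF pp. 105–109)

Mochizuki, *The étale theta function and its Frobenioid-theoretic manifestations*, Publ. RIMS **45**
(2009) [cite: MochizukiEtTh2009, Thm 5.10 (iii) p.334 (PDF p.108)]; Lemma 5.8 p.331 (PDF p.105); Lemma 5.9 (iv)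
p.332 (PDF p.106).  Layer L2 of the abc-iut cell, seat abc-iut-L2-t11 (gen 4); GAP-LEDGER row **G-L2lead-1**
(`hDK`), abc-iut-L2-lead (gen 3) ruling R174 / chair GO 2026-08-26T08:23:21Z «BOTH HALVES at the nonempty Kummer
part».  PROOF-ONLY (0 defs; nothing landed is edited).

WHAT IS PROVED.  abc-iut-L2-d4's Theorem 5.10 (iii) (`exists_monoThetaIso_of_isEnvCompatible` /
`exists_monoThetaIso_of_psiAutPreserves`, `Discharge/Sec5Thm510iii.lean`) carries the remaining Kummer part
`DK ⊆ Out(E^Π_N)` of `D = ⟨l·ℤ, K^×⟩` (Lemma 5.9 (iv): "generated by the natural outer actions of `l·ℤ` [cf.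
(iii)], `K^×` [cf. Lemma 5.8] on `E_N`") as a PARAMETER with a stability hypothesis `hDK` ("`γ` maps `DK` into
`D`"), discharged so far only VACUOUSLY at `DK := ∅` (`Discharge/Sec5Thm510.lean`) and, by abc-iut-L6-t23
(`Discharge/Sec5Thm510iiiKummerPart.lean`), at the instance of record `DK₀ := (E^Π_N ⥲ Π^tp_Y[μ_N])⁻¹(kummerOut(D_Y))`
modulo [EtTh] Cor. 2.18 (i).  Here `DK` is the INTRINSIC `K^×`-part of this seat's `FrobenioidKummerOut.lean`
(gen 2): `BiratAutAction.kummerOut` = the classes of "conjugation by `f ∈ (K^×)^{1/N} ⊆ O^×(B_N^birat)`"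
(Lemma 5.8: "this outer action extends to an outer action of `(K^×)^{1/N}/μ_N(B_N) ⥲ K^×` on `E_N`"), a NONEMPTY
datum defined from the §5 data and the natural action `α` of `Aut_C(B_N)` on `O^×(B_N^birat)` alone.

(A) INTRINSIC ROUTE (no §2 model, no Galois dictionary, no Cor. 2.18 (i)).  Print (Thm. 5.10 (ii), p.334):
"`Ψ^Aut`, `Ψ^birat_Aut` preserve … `(K^×)^{1/N} ⊆ O^×(B_N^birat)`".  For a compatible pair `(Φ, ψ)` of
abc-iut-L2-d4 (`IsEnvCompatible`) carrying a BIRATIONAL COMPANION `F : O^×(B_N^birat) ⥲ O^×(B_N^birat)` — `Φ`-semilinear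
for `α` (`F(e·x) = Φ(e)·F(x)`), extending `Φ` on `μ_N(B_N)`, and preserving `(K^×)^{1/N}` — the automorphism
`γ = (Φ, ψ)|_{E^Π_N}` transports "conjugation by `f`" to "conjugation by `F f`"
(`transport_envAut_kummerOutHom`: `Φ(κ_f(e)) = κ_{F f}(Φ e)` for the Kummer cocycles), hence stabilises `kummerOut`
(`transport_envAut_mem_kummerOut`).  In the situation of Theorem 5.10, `Φ = κ⁻¹ ∘ Ψ^Aut` (`κ = Inn(δ₁·δ₂·δ₃)`)
has the companion `F := (δ₁·δ₂·δ₃)⁻¹ · Ψ^birat_Aut(−)`, granted the ONE functoriality law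
`hsemi : Ψ^birat_Aut(e·x) = Ψ^Aut(e)·Ψ^birat_Aut(x)` (both are induced by the self-equivalence `Ψ` of `C` and
its birationalisation, [FrdI] Prop. 4.4; at abc-iut-L2-t4's genuine data `ofConnectedTemperoidData` both come
from abc-iut-L2-t9's `biratAutModel` — an honest, junction-dischargeable binder of the same kind as the three laws
of `BiratAutAction`).  RESULT: `exists_monoThetaIso_of_psiAutPreserves_kummerOut`,
`monoThetaEnvCompat_kummerOut_of_psiAutPreserves` (abc-iut-L2-t4's `MonoThetaEnvCompat` at
`DK := kummerOut`), and `Facts.thm510_ii_iii_kummerOut` (Thm. 5.10 (ii) ∧ (iii) at `DK := kummerOut` from Thm. 5.7,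
Thm. 4.4 (iv) and the bundled §5 facts, as abc-iut-L2-t4's `Facts.thm510_ii_iii_of_transports`).
(B) The route BY NAME from the Galois dictionary (the `hDK` binder for EVERY compatible pair, from `kummerOut ⊆ DK₀`,
abc-iut-L6-t23's stability of `DK₀` and `D(kummerOut) = D(DK₀)`) is the companion file
`Discharge/Sec5Thm510iiiKummerOutOfDictionary.lean`.  Either way [IUTchII] Prop. 1.2 (ii)'s binder `hM` (Lemma 5.9 (iv)
"In particular", this seat's `frdIsMonoThetaEnv_birat_of_galoisDictionary`) and Theorem 5.10 (iii) now speak of the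
SAME nonempty object `frdMonoThetaEnv … (kummerOut)`.
HONEST FRAMING: kernel-checked implications over the typed §5 interface; the birational action `α`, the companion
law `hsemi`, resp. the Galois dictionary of the constants and Cor. 2.18 (i), are hypotheses named in each
signature; nothing of [EtTh] is asserted unconditionally; typed ≠ proved; no side is taken on anything
downstream ([IUTchIII] Cor. 3.12).
-/

namespace Literature.AnabelianGeometry.EtaleTheta

open CategoryTheory
open scoped Pointwise

universe w v v' u u'

namespace ThetaFrobenioid

variable {C : Type u} [Category.{v} C] {D : Type u'} [Category.{v'} D] {𝔉 : ThetaFrobenioid.{w} C D}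

/-- Underlying pair of `γ⁻¹ x` for the automorphism `γ = (Φ, ψ)|_{E^Π_N}` of abc-iut-L2-d4 (`envAut`):
`(Φ⁻¹ e, ψ⁻¹ y)`.  [cite: MochizukiEtTh2009, Thm 5.10 (iii) p.335 (PDF p.109)] -/
@[simp] theorem coe_envAut_symm {Φ : Aut 𝔉.BN ≃* Aut 𝔉.BN} {ψ : 𝔉.PiX ≃ₜ* 𝔉.PiX}
    (h : 𝔉.StabilizesEPiN Φ ψ) (x : 𝔉.EPiN) :
    (((𝔉.envAut h).symm x : 𝔉.EPiN) : Aut 𝔉.BN × 𝔉.PiX) = (Φ.symm x.1.1, ψ.symm x.1.2) := rfl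

namespace BiratAutAction

variable (α : 𝔉.BiratAutAction) (hK : 𝔉.KxRootNModCyclotome)

/-! ### (A) The intrinsic route: a compatible pair with a birational companion stabilises `kummerOut` -/

section Companion

/-- The natural action of `Aut_C(B_N)` on `O^×(B_N^birat)` preserves `(K^×)^{1/N}` (constants are fixed:
`(e·f)^N = e·f^N = f^N ∈ K^×`; Thm. 5.10 (ii): "… preserve … `(K^×)^{1/N} ⊆ O^×(B_N^birat)`").
[cite: MochizukiEtTh2009, Lem 5.8 p.331 (PDF p.105)] -/
theorem act_mem_KxRootN_iff (e : Aut 𝔉.BN) (f : 𝔉.biratUnits 𝔉.BN) :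
    α.act e f ∈ 𝔉.KxRootN ↔ f ∈ 𝔉.KxRootN := by
  have key : ∀ (e : Aut 𝔉.BN) (f : 𝔉.biratUnits 𝔉.BN), f ∈ 𝔉.KxRootN → α.act e f ∈ 𝔉.KxRootN := by
    intro e f hf
    rw [𝔉.mem_KxRootN] at hf ⊢
    obtain ⟨k, hk⟩ := hf
    rw [← map_pow, ← hk, α.act_constEmb]
    exact ⟨k, rfl⟩
  refine ⟨fun h => ?_, key e f⟩
  have h' := key e⁻¹ _ h
  rwa [← MulAut.mul_apply, ← map_mul, inv_mul_cancel, map_one, MulAut.one_apply] at h'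

/-- `(k⁻¹·b·k)·(k⁻¹·y) = k⁻¹·(b·y)` for the natural action (bookkeeping for the companion of `κ⁻¹ ∘ Ψ^Aut`).
[cite: MochizukiEtTh2009, Thm 5.10 (iii) p.335 (PDF p.109)] -/
theorem act_conj_act_inv (k b : Aut 𝔉.BN) (y : 𝔉.biratUnits 𝔉.BN) :
    α.act (k⁻¹ * b * k) (α.act k⁻¹ y) = α.act k⁻¹ (α.act b y) := by
  rw [map_mul, map_mul, MulAut.mul_apply, MulAut.mul_apply, map_inv, MulAut.apply_inv_self]

/-- `μ_N(B_N) → O^×(B_N^birat)` is `O^×(B_N) ↪ O^×(B_N^birat)` on the underlying unit (unfolding lemma).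
[cite: MochizukiEtTh2009, Lem 5.8 p.331 (PDF p.105)] -/
theorem muToBirat_eq_unitsToBirat (u : 𝔉.muTorsion 𝔉.BN 𝔉.N) :
    𝔉.muToBirat u = 𝔉.unitsToBirat 𝔉.BN ⟨(u : Aut 𝔉.BN), 𝔉.muTorsion_le_units _ _ u.2⟩ := rfl

variable {Φ : Aut 𝔉.BN ≃* Aut 𝔉.BN} {ψ : 𝔉.PiX ≃ₜ* 𝔉.PiX}

/-- **`Φ(κ_f(e)) = κ_{F f}(Φ e)`**: a compatible pair `(Φ, ψ)` with a birational companion `F` (`Φ`-semilinear for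
the natural action, extending `Φ` on `μ_N(B_N) ⊆ O^×(B_N^birat)`, preserving `(K^×)^{1/N}`) carries the Kummer cocycle
`κ_f(e) = (e·f)·f⁻¹` of an `N`-th root of a constant `f` (proof of Lemma 5.8) to that of `F f`.
[cite: MochizukiEtTh2009, Lem 5.8 p.331 (PDF p.105); Thm 5.10 (iii) p.335 (PDF p.109)] -/
theorem apply_kummerCocycle_eq_companion (hc : 𝔉.IsEnvCompatible Φ ψ)
    (F : 𝔉.biratUnits 𝔉.BN ≃* 𝔉.biratUnits 𝔉.BN)
    (hF₁ : ∀ (a : Aut 𝔉.BN) (x : 𝔉.biratUnits 𝔉.BN), F (α.act a x) = α.act (Φ a) (F x))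
    (hF₂ : ∀ (u : 𝔉.muTorsion 𝔉.BN 𝔉.N) (hu : Φ u ∈ 𝔉.muTorsion 𝔉.BN 𝔉.N),
      F (𝔉.muToBirat u) = 𝔉.muToBirat ⟨Φ u, hu⟩)
    (hF₃ : ∀ f : 𝔉.biratUnits 𝔉.BN, F f ∈ 𝔉.KxRootN ↔ f ∈ 𝔉.KxRootN) (f : 𝔉.KxRootN) (e : Aut 𝔉.BN) :
    Φ (α.kummerCocycle hK f e : Aut 𝔉.BN) =
      (α.kummerCocycle hK ⟨F f, (hF₃ f).mpr f.2⟩ (Φ e) : Aut 𝔉.BN) := by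
  have hu : Φ (α.kummerCocycle hK f e : Aut 𝔉.BN) ∈ 𝔉.muTorsion 𝔉.BN 𝔉.N :=
    hc.apply_mem_muTorsion (α.kummerCocycle hK f e).2
  suffices h : (⟨Φ (α.kummerCocycle hK f e : Aut 𝔉.BN), hu⟩ : 𝔉.muTorsion 𝔉.BN 𝔉.N) =
      α.kummerCocycle hK ⟨F f, (hF₃ f).mpr f.2⟩ (Φ e) from congrArg Subtype.val h
  apply 𝔉.muToBirat_injective
  rw [← hF₂ (α.kummerCocycle hK f e) hu, α.muToBirat_kummerCocycle, α.muToBirat_kummerCocycle, map_mul,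
    map_inv, hF₁]

/-- **`γ ∘ (conjugation by f) ∘ γ⁻¹ = conjugation by F f` on `E^Π_N`**, pointwise, for `γ = (Φ, ψ)|_{E^Π_N}`
(abc-iut-L2-d4's `envAut`) and "conjugation by `f ∈ (K^×)^{1/N}`" (this seat's `kummerAutHom`: `(e, y) ↦ (κ_f(e)⁻¹·e, y)`).
[cite: MochizukiEtTh2009, Thm 5.10 (iii) p.335 (PDF p.109)] -/
theorem envAut_kummerAutHom_symm_apply (hc : 𝔉.IsEnvCompatible Φ ψ)
    (hsec : 𝔉.SgpCapSection) (F : 𝔉.biratUnits 𝔉.BN ≃* 𝔉.biratUnits 𝔉.BN)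
    (hF₁ : ∀ (a : Aut 𝔉.BN) (x : 𝔉.biratUnits 𝔉.BN), F (α.act a x) = α.act (Φ a) (F x))
    (hF₂ : ∀ (u : 𝔉.muTorsion 𝔉.BN 𝔉.N) (hu : Φ u ∈ 𝔉.muTorsion 𝔉.BN 𝔉.N),
      F (𝔉.muToBirat u) = 𝔉.muToBirat ⟨Φ u, hu⟩)
    (hF₃ : ∀ f : 𝔉.biratUnits 𝔉.BN, F f ∈ 𝔉.KxRootN ↔ f ∈ 𝔉.KxRootN) (f : 𝔉.KxRootN) (x : 𝔉.EPiN) :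
    𝔉.envAut (hc.stabilizesEPiN hsec)
        (α.kummerAutHom hK f ((𝔉.envAut (hc.stabilizesEPiN hsec)).symm x)) =
      α.kummerAutHom hK ⟨F f, (hF₃ f).mpr f.2⟩ x := by
  apply Subtype.ext
  simp only [kummerAutHom_apply, coe_envAut, coe_kummerEnd, coe_envAut_symm]
  refine Prod.ext ?_ ?_
  · simp only [map_mul, map_inv, MulEquiv.apply_symm_apply]
    rw [α.apply_kummerCocycle_eq_companion hK hc F hF₁ hF₂ hF₃ f (Φ.symm x.1.1),
      MulEquiv.apply_symm_apply]
  · simp only [ContinuousMulEquiv.apply_symm_apply]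

/-- **Transport of the `K^×`-generators of `D`**: `γ = (Φ, ψ)|_{E^Π_N}` carries the outer automorphism
"conjugation by `f ∈ (K^×)^{1/N}`" (Lemma 5.8 / Lemma 5.9 (iv)) to "conjugation by `F f`" — print (Thm. 5.10 (ii)):
"`Ψ^birat_Aut` … preserve[s] … `(K^×)^{1/N} ⊆ O^×(B_N^birat)`".
[cite: MochizukiEtTh2009, Thm 5.10 (iii) p.334–335 (PDF pp.108–109)] -/
theorem transport_envAut_kummerOutHom (hc : 𝔉.IsEnvCompatible Φ ψ)
    (hsec : 𝔉.SgpCapSection) (F : 𝔉.biratUnits 𝔉.BN ≃* 𝔉.biratUnits 𝔉.BN)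
    (hF₁ : ∀ (a : Aut 𝔉.BN) (x : 𝔉.biratUnits 𝔉.BN), F (α.act a x) = α.act (Φ a) (F x))
    (hF₂ : ∀ (u : 𝔉.muTorsion 𝔉.BN 𝔉.N) (hu : Φ u ∈ 𝔉.muTorsion 𝔉.BN 𝔉.N),
      F (𝔉.muToBirat u) = 𝔉.muToBirat ⟨Φ u, hu⟩)
    (hF₃ : ∀ f : 𝔉.biratUnits 𝔉.BN, F f ∈ 𝔉.KxRootN ↔ f ∈ 𝔉.KxRootN) (f : 𝔉.KxRootN) :
    TopOut.transport (𝔉.envAut (hc.stabilizesEPiN hsec)) (α.kummerOutHom hK f) =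
      α.kummerOutHom hK ⟨F f, (hF₃ f).mpr f.2⟩ := by
  rw [kummerOutHom_apply, kummerOutHom_apply, TopOut.transport_mk]
  congr 1
  apply Subtype.ext
  apply MulEquiv.ext
  intro x
  exact α.envAut_kummerAutHom_symm_apply hK hc hsec F hF₁ hF₂ hF₃ f x

/-- **`γ` STABILISES THE `K^×`-PART `kummerOut`** (the `hDK` clause of GAP-LEDGER G-L2lead-1 at the intrinsic,
nonempty `DK := kummerOut`, for a compatible pair with a birational companion).
[cite: MochizukiEtTh2009, Thm 5.10 (iii) p.334 (PDF p.108)] -/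
theorem transport_envAut_mem_kummerOut (hc : 𝔉.IsEnvCompatible Φ ψ)
    (hsec : 𝔉.SgpCapSection) (F : 𝔉.biratUnits 𝔉.BN ≃* 𝔉.biratUnits 𝔉.BN)
    (hF₁ : ∀ (a : Aut 𝔉.BN) (x : 𝔉.biratUnits 𝔉.BN), F (α.act a x) = α.act (Φ a) (F x))
    (hF₂ : ∀ (u : 𝔉.muTorsion 𝔉.BN 𝔉.N) (hu : Φ u ∈ 𝔉.muTorsion 𝔉.BN 𝔉.N),
      F (𝔉.muToBirat u) = 𝔉.muToBirat ⟨Φ u, hu⟩)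
    (hF₃ : ∀ f : 𝔉.biratUnits 𝔉.BN, F f ∈ 𝔉.KxRootN ↔ f ∈ 𝔉.KxRootN) {d : TopOut 𝔉.EPiN} (hd : d ∈ α.kummerOut hK) :
    TopOut.transport (𝔉.envAut (hc.stabilizesEPiN hsec)) d ∈ α.kummerOut hK := by
  obtain ⟨f, rfl⟩ := hd
  exact ⟨⟨F f, (hF₃ f).mpr f.2⟩, (α.transport_envAut_kummerOutHom hK hc hsec F hF₁ hF₂ hF₃ f).symm⟩

/-- … hence into `D = ⟨l·ℤ-part, (O_K^×)^{1/N}-part, kummerOut⟩` of abc-iut-L2-t4's `frdMonoThetaEnv … (kummerOut)` —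
the literal `hDK` binder shape of abc-iut-L2-d4's `exists_monoThetaIso_of_isEnvCompatible`.
[cite: MochizukiEtTh2009, Thm 5.10 (iii) p.334 (PDF p.108)] -/
theorem transport_envAut_mem_D_kummerOut (hc : 𝔉.IsEnvCompatible Φ ψ)
    (hsec : 𝔉.SgpCapSection) (F : 𝔉.biratUnits 𝔉.BN ≃* 𝔉.biratUnits 𝔉.BN)
    (hF₁ : ∀ (a : Aut 𝔉.BN) (x : 𝔉.biratUnits 𝔉.BN), F (α.act a x) = α.act (Φ a) (F x))
    (hF₂ : ∀ (u : 𝔉.muTorsion 𝔉.BN 𝔉.N) (hu : Φ u ∈ 𝔉.muTorsion 𝔉.BN 𝔉.N),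
      F (𝔉.muToBirat u) = 𝔉.muToBirat ⟨Φ u, hu⟩)
    (hF₃ : ∀ f : 𝔉.biratUnits 𝔉.BN, F f ∈ 𝔉.KxRootN ↔ f ∈ 𝔉.KxRootN) (h1 : 𝔉.SectionsFactor) (h3 : 𝔉.OuterActionLZ)
    (hcs : 𝔉.SgpCupSection) (h8 : 𝔉.ConstantsEqNormalizer) {d : TopOut 𝔉.EPiN} (hd : d ∈ α.kummerOut hK) :
    TopOut.transport (𝔉.envAut (hc.stabilizesEPiN hsec)) d ∈
      (𝔉.frdMonoThetaEnv h1 h3 hsec hcs h8 (α.kummerOut hK)).D :=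
  Subgroup.subset_closure (Or.inr (α.transport_envAut_mem_kummerOut hK hc hsec F hF₁ hF₂ hF₃ hd))

/-- The inverse companion `F⁻¹` is `Φ⁻¹`-semilinear. [cite: MochizukiEtTh2009, Thm 5.10 (iii) p.335 (PDF p.109)] -/
theorem companion_symm_semilinear (F : 𝔉.biratUnits 𝔉.BN ≃* 𝔉.biratUnits 𝔉.BN)
    (hF₁ : ∀ (a : Aut 𝔉.BN) (x : 𝔉.biratUnits 𝔉.BN), F (α.act a x) = α.act (Φ a) (F x))
    (a : Aut 𝔉.BN) (x : 𝔉.biratUnits 𝔉.BN) :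
    F.symm (α.act a x) = α.act (Φ.symm a) (F.symm x) := by
  apply F.injective
  rw [F.apply_symm_apply, hF₁, MulEquiv.apply_symm_apply, F.apply_symm_apply]

/-- The inverse companion `F⁻¹` extends `Φ⁻¹` on `μ_N(B_N)`. [cite: MochizukiEtTh2009, Thm 5.10 (iii) p.335 (PDF p.109)] -/
theorem companion_symm_muToBirat (F : 𝔉.biratUnits 𝔉.BN ≃* 𝔉.biratUnits 𝔉.BN)
    (hF₂ : ∀ (u : 𝔉.muTorsion 𝔉.BN 𝔉.N) (hu : Φ u ∈ 𝔉.muTorsion 𝔉.BN 𝔉.N),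
      F (𝔉.muToBirat u) = 𝔉.muToBirat ⟨Φ u, hu⟩)
    (u : 𝔉.muTorsion 𝔉.BN 𝔉.N) (hu : Φ.symm u ∈ 𝔉.muTorsion 𝔉.BN 𝔉.N) :
    F.symm (𝔉.muToBirat u) = 𝔉.muToBirat ⟨Φ.symm u, hu⟩ := by
  apply F.injective
  have hu' : Φ ((⟨Φ.symm u, hu⟩ : 𝔉.muTorsion 𝔉.BN 𝔉.N) : Aut 𝔉.BN) ∈ 𝔉.muTorsion 𝔉.BN 𝔉.N := by
    change Φ (Φ.symm u) ∈ 𝔉.muTorsion 𝔉.BN 𝔉.N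
    rw [MulEquiv.apply_symm_apply]
    exact u.2
  rw [F.apply_symm_apply, hF₂ _ hu']
  congr 1
  apply Subtype.ext
  exact (MulEquiv.apply_symm_apply Φ u).symm

/-- The inverse companion `F⁻¹` preserves `(K^×)^{1/N}`. [cite: MochizukiEtTh2009, Thm 5.10 (iii) p.335 (PDF p.109)] -/
theorem companion_symm_mem_KxRootN_iff (F : 𝔉.biratUnits 𝔉.BN ≃* 𝔉.biratUnits 𝔉.BN)
    (hF₃ : ∀ f : 𝔉.biratUnits 𝔉.BN, F f ∈ 𝔉.KxRootN ↔ f ∈ 𝔉.KxRootN) (f : 𝔉.biratUnits 𝔉.BN) :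
    F.symm f ∈ 𝔉.KxRootN ↔ f ∈ 𝔉.KxRootN := by
  rw [← hF₃ (F.symm f), F.apply_symm_apply]

end Companion

/-! ### (A′) Theorem 5.10 (iii) at `DK := kummerOut` from Theorem 5.10 (ii) and the functoriality law `hsemi` -/

section Thm510iii

/-- **[EtTh] Theorem 5.10 (iii) for the mono-theta environment with the HONEST `K^×`-part** `DK := kummerOut`
("the subgroup of `Out(E^Π_N)` generated by the natural outer actions of `l·ℤ`, `K^×`", Lemma 5.9 (iv)) — the GAP
row G-L2lead-1 `hDK` DISCHARGED at a NONEMPTY `DK`, intrinsically: from Theorem 5.10 (ii) as typed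
(`PsiAutPreserves Ψ β Ψ^birat_Aut`: "`Ψ^Aut`, `Ψ^birat_Aut` preserve `O^×(B_N)` … `(K^×)^{1/N}`" and the `δ`-conjugates
of `E_N`, `Im(s^⊔-gp_N)`), a representative `ψY` of the automorphisms of `Π^tp_X̲` induced by `Ψ^bs` (over `Ψ^Aut`
through `ρ`, preserving `Π^tp_Y̲`, `Π^tp_Ÿ̲`), and ONE functoriality law `hsemi : Ψ^birat_Aut(e·x) = Ψ^Aut(e)·Ψ^birat_Aut(x)`
("the natural action" of `Aut_C(B_N)` on `O^×(B_N^birat)` commutes with `Ψ`; [FrdI] Prop. 4.4): "there exists a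
commutative diagram `Ψ^Aut ∘ ϵ = (κ ∘ ϵ) ∘ γ` — where `κ` is an inner automorphism; `γ` … determines an automorphism of
mono-theta environments and is compatible with the `Π^tp_X`-conjugacy class of automorphisms of `Π^tp_Y` induced by
`Ψ^bs`" (p.334).  Route: abc-iut-L2-d4's compatible pair `(κ⁻¹ ∘ Ψ^Aut, Inn(x₃⁻¹) ∘ ψY)` with the birational companion
`F := (δ₁·δ₂·δ₃)⁻¹ · Ψ^birat_Aut(−)`.  [cite: MochizukiEtTh2009, Thm 5.10 (iii) p.334–335 (PDF pp.108–109)] -/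
theorem exists_monoThetaIso_of_psiAutPreserves_kummerOut (h1 : 𝔉.SectionsFactor)
    (h3 : 𝔉.OuterActionLZ) (hsec : 𝔉.SgpCapSection) (hcs : 𝔉.SgpCupSection)
    (h8 : 𝔉.ConstantsEqNormalizer) (Ψ : C ≌ C) (β : Ψ.functor.obj 𝔉.BN ≅ 𝔉.BN)
    (ΨbiratAut : 𝔉.biratUnits 𝔉.BN ≃* 𝔉.biratUnits 𝔉.BN) (hii : 𝔉.PsiAutPreserves Ψ β ΨbiratAut)
    (hsemi : ∀ (a : Aut 𝔉.BN) (x : 𝔉.biratUnits 𝔉.BN),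
      ΨbiratAut (α.act a x) = α.act (𝔉.psiAut Ψ β a) (ΨbiratAut x))
    (ψY : 𝔉.PiX ≃ₜ* 𝔉.PiX)
    (hbase : ∀ g, 𝔉.autBase 𝔉.BN (𝔉.psiAut Ψ β (𝔉.sgpCap (𝔉.ρ g))) = 𝔉.ρ (ψY g))
    (hY : 𝔉.PiY.map ψY.toMulEquiv.toMonoidHom = 𝔉.PiY)
    (hYdd : 𝔉.PiYdd.map ψY.toMulEquiv.toMonoidHom = 𝔉.PiYdd) :
    ∃ (x₃ : 𝔉.PiX) (γ : (𝔉.frdMonoThetaEnv h1 h3 hsec hcs h8 (α.kummerOut hK)).Iso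
        (𝔉.frdMonoThetaEnv h1 h3 hsec hcs h8 (α.kummerOut hK))) (k : Aut 𝔉.BN),
      (∀ x, 𝔉.psiAut Ψ β (𝔉.epsilon x) = k * 𝔉.epsilon (γ.e x) * k⁻¹) ∧
        ∀ x, 𝔉.toPiY (γ.e x) = (ψY.trans (𝔉.conjTop x₃⁻¹)) (𝔉.toPiY x) := by
  obtain ⟨hU, -, hsq, hKx, δ₁, δ₂, δ₃, hδ₁, hδ₂, hδ₃, hE, -, hcup⟩ := hii
  obtain ⟨x₃, hx₃⟩ := 𝔉.ρ_surjective (𝔉.autBase 𝔉.BN δ₃)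
  have hc := isEnvCompatible_of_thm510ii h3 h8 (𝔉.psiAutEquiv Ψ β) hδ₁ (Subgroup.mem_inf.mp hδ₂).2
    hδ₃ (by rwa [psiAutEquiv_toMonoidHom]) (by rwa [psiAutEquiv_toMonoidHom])
    (by rwa [psiAutEquiv_toMonoidHom]) ψY (fun g => hbase g) hY hYdd x₃ hx₃
  have hΦ : ∀ a, ((𝔉.psiAutEquiv Ψ β).trans (MulAut.conj (δ₁ * δ₂ * δ₃)⁻¹)) a =
      (δ₁ * δ₂ * δ₃)⁻¹ * 𝔉.psiAut Ψ β a * (δ₁ * δ₂ * δ₃) := fun a => by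
    rw [MulEquiv.trans_apply, MulAut.conj_apply, inv_inv, psiAutEquiv_apply]
  -- the birational companion of `Φ = κ⁻¹ ∘ Ψ^Aut`: `F := (δ₁·δ₂·δ₃)⁻¹ · Ψ^birat_Aut(−)`
  have hF₁ : ∀ (a : Aut 𝔉.BN) (x : 𝔉.biratUnits 𝔉.BN),
      (ΨbiratAut.trans (α.act (δ₁ * δ₂ * δ₃)⁻¹)) (α.act a x) =
        α.act (((𝔉.psiAutEquiv Ψ β).trans (MulAut.conj (δ₁ * δ₂ * δ₃)⁻¹)) a)
          ((ΨbiratAut.trans (α.act (δ₁ * δ₂ * δ₃)⁻¹)) x) := by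
    intro a x
    rw [hΦ, MulEquiv.trans_apply, MulEquiv.trans_apply, hsemi, α.act_conj_act_inv]
  have hF₂ : ∀ (u : 𝔉.muTorsion 𝔉.BN 𝔉.N)
      (hu : ((𝔉.psiAutEquiv Ψ β).trans (MulAut.conj (δ₁ * δ₂ * δ₃)⁻¹)) u ∈ 𝔉.muTorsion 𝔉.BN 𝔉.N),
      (ΨbiratAut.trans (α.act (δ₁ * δ₂ * δ₃)⁻¹)) (𝔉.muToBirat u) =
        𝔉.muToBirat ⟨((𝔉.psiAutEquiv Ψ β).trans (MulAut.conj (δ₁ * δ₂ * δ₃)⁻¹)) u, hu⟩ := by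
    intro u hu
    have hu' : 𝔉.psiAut Ψ β u ∈ 𝔉.units 𝔉.BN :=
      hU.le (Subgroup.mem_map_of_mem (𝔉.psiAut Ψ β) (𝔉.muTorsion_le_units _ _ u.2))
    rw [MulEquiv.trans_apply, muToBirat_eq_unitsToBirat, muToBirat_eq_unitsToBirat,
      hsq ⟨(u : Aut 𝔉.BN), 𝔉.muTorsion_le_units _ _ u.2⟩ hu', α.act_unitsToBirat]
    rfl
  have hF₃ : ∀ f : 𝔉.biratUnits 𝔉.BN,
      (ΨbiratAut.trans (α.act (δ₁ * δ₂ * δ₃)⁻¹)) f ∈ 𝔉.KxRootN ↔ f ∈ 𝔉.KxRootN := by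
    intro f
    rw [MulEquiv.trans_apply, α.act_mem_KxRootN_iff, mem_iff_of_map_equiv_eq hKx]
  refine ⟨x₃, exists_monoThetaIso_of_isEnvCompatible h1 h3 hsec hcs h8 _ Ψ β (δ₁ * δ₂ * δ₃) hc hΦ
    (fun d hd => α.transport_envAut_mem_D_kummerOut hK hc hsec _ hF₁ hF₂ hF₃ h1 h3 hcs h8 hd)
    (fun d hd => α.transport_envAut_mem_D_kummerOut hK (hc.symm hsec) hsec _
      (α.companion_symm_semilinear _ hF₁) (companion_symm_muToBirat _ hF₂)
      (companion_symm_mem_KxRootN_iff _ hF₃) h1 h3 hcs h8 hd)⟩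

/-- **[EtTh] Theorem 5.10 (iii) as typed (abc-iut-L2-t4's `MonoThetaEnvCompat`) at the honest `K^×`-part
`DK := kummerOut`** — in place of the truncated `DK = ∅` of `Discharge/Sec5Thm510.lean` and beside abc-iut-L6-t23's
`DK₀`-version: rewrap of `exists_monoThetaIso_of_psiAutPreserves_kummerOut`.
[cite: MochizukiEtTh2009, Thm 5.10 (iii) p.334–335 (PDF pp.108–109)] -/
theorem monoThetaEnvCompat_kummerOut_of_psiAutPreserves (h1 : 𝔉.SectionsFactor)
    (h3 : 𝔉.OuterActionLZ) (hsec : 𝔉.SgpCapSection) (hcs : 𝔉.SgpCupSection)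
    (h8 : 𝔉.ConstantsEqNormalizer) (Ψ : C ≌ C) (β : Ψ.functor.obj 𝔉.BN ≅ 𝔉.BN)
    (ΨbiratAut : 𝔉.biratUnits 𝔉.BN ≃* 𝔉.biratUnits 𝔉.BN) (hii : 𝔉.PsiAutPreserves Ψ β ΨbiratAut)
    (hsemi : ∀ (a : Aut 𝔉.BN) (x : 𝔉.biratUnits 𝔉.BN),
      ΨbiratAut (α.act a x) = α.act (𝔉.psiAut Ψ β a) (ΨbiratAut x))
    (ψY : 𝔉.PiX ≃ₜ* 𝔉.PiX)
    (hbase : ∀ g, 𝔉.autBase 𝔉.BN (𝔉.psiAut Ψ β (𝔉.sgpCap (𝔉.ρ g))) = 𝔉.ρ (ψY g))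
    (hY : 𝔉.PiY.map ψY.toMulEquiv.toMonoidHom = 𝔉.PiY)
    (hYdd : 𝔉.PiYdd.map ψY.toMulEquiv.toMonoidHom = 𝔉.PiYdd) :
    𝔉.MonoThetaEnvCompat h1 h3 hsec hcs h8 (α.kummerOut hK) Ψ β ψY hbase hY hYdd := by
  obtain ⟨x₃, γ, k, hk, hγ⟩ := α.exists_monoThetaIso_of_psiAutPreserves_kummerOut hK h1 h3 hsec hcs h8 Ψ β
    ΨbiratAut hii hsemi ψY hbase hY hYdd
  exact ⟨x₃, γ, k, hk, fun x => by rw [hγ x, ContinuousMulEquiv.trans_apply, conjTop_apply, inv_inv]⟩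

end Thm510iii

end BiratAutAction

/-- **[EtTh] Theorem 5.10 (ii) ∧ (iii) at the honest `K^×`-part `DK := kummerOut`, from Theorem 5.7, Theorem 4.4
(iv) (both BY NAME) and the bundled §5 facts** — abc-iut-L2-t4's `Facts.thm510_ii_iii_of_transports` with the
vacuous `DK = ∅` replaced by the nonempty intrinsic `K^×`-part, at the price of the one functoriality law `hsemi`;
NO §2 model data, NO Galois dictionary, NO Cor. 2.18 (i).
[cite: MochizukiEtTh2009, Thm 5.10 (ii)(iii) p.333–335 (PDF pp.107–109); Thm 4.4 (iv) p.320 (PDF p.94)] -/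
theorem Facts.thm510_ii_iii_kummerOut (H : 𝔉.Facts) (αK : 𝔉.BiratAutAction)
    (hK : 𝔉.KxRootNModCyclotome) (Ψ : C ≌ C) (β : Ψ.functor.obj 𝔉.BN ≅ 𝔉.BN)
    (ΨbiratAut : 𝔉.biratUnits 𝔉.BN ≃* 𝔉.biratUnits 𝔉.BN)
    (Ψbs : D ⥤ D) [Ψbs.Faithful] (eΨ : Ψ.functor ⋙ 𝔉.base ≅ 𝔉.base ⋙ Ψbs)
    (hsq : ∀ u : 𝔉.units 𝔉.BN, ∀ hu : 𝔉.psiAut Ψ β u ∈ 𝔉.units 𝔉.BN,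
      ΨbiratAut (𝔉.unitsToBirat 𝔉.BN u) = 𝔉.unitsToBirat 𝔉.BN ⟨_, hu⟩)
    (hconst : 𝔉.constEmb.range.map ΨbiratAut.toMonoidHom = 𝔉.constEmb.range)
    (hsemi : ∀ (a : Aut 𝔉.BN) (x : 𝔉.biratUnits 𝔉.BN),
      ΨbiratAut (αK.act a x) = αK.act (𝔉.psiAut Ψ β a) (ΨbiratAut x))
    (αA : Ψ.functor.obj 𝔉.AN ≅ 𝔉.AN) (e : 𝔉.AN ≅ 𝔉.AN) (Dc Dp : Aut 𝔉.BN)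
    (hRT : 𝔉.RootTransportWith Ψ αA β e Dc Dp)
    (θ : Aut (𝔉.base.obj 𝔉.BN) ≃* Aut (𝔉.base.obj 𝔉.BN)) (hST : 𝔉.StrvTransport Ψ αA e θ)
    (hθY : 𝔉.imPiY.map θ.toMonoidHom = 𝔉.imPiY) (hθYdd : 𝔉.HB.map θ.toMonoidHom = 𝔉.HB)
    (ψY : 𝔉.PiX ≃ₜ* 𝔉.PiX)
    (hbase : ∀ g, 𝔉.autBase 𝔉.BN (𝔉.psiAut Ψ β (𝔉.sgpCap (𝔉.ρ g))) = 𝔉.ρ (ψY g))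
    (hψY : 𝔉.PiY.map ψY.toMulEquiv.toMonoidHom = 𝔉.PiY)
    (hψYdd : 𝔉.PiYdd.map ψY.toMulEquiv.toMonoidHom = 𝔉.PiYdd) :
    𝔉.PsiAutPreserves Ψ β ΨbiratAut ∧
      𝔉.MonoThetaEnvCompat H.sectionsFactor 𝔉.outerActionLZ_of H.sgpCapSection H.sgpCupSection
        H.constantsEqNormalizer (αK.kummerOut hK) Ψ β ψY hbase hψY hψYdd :=
  have hii : 𝔉.PsiAutPreserves Ψ β ΨbiratAut :=
    H.psiAutPreserves_of_transports Ψ β ΨbiratAut Ψbs eΨ hsq hconst αA e Dc Dp hRT θ hST hθY hθYdd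
  ⟨hii, αK.monoThetaEnvCompat_kummerOut_of_psiAutPreserves hK H.sectionsFactor 𝔉.outerActionLZ_of
    H.sgpCapSection H.sgpCupSection H.constantsEqNormalizer Ψ β ΨbiratAut hii hsemi ψY hbase hψY hψYdd⟩

end ThetaFrobenioid

end Literature.AnabelianGeometry.EtaleTheta
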